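import Literature.MathematicalPhysics.QuantumFieldTheory.Balaban1983to89.B13CoerciveAlongPencil
import Literature.MathematicalPhysics.QuantumFieldTheory.Balaban1983to89.B13OpsYPencilRProjSymLocated
import Literature.MathematicalPhysics.QuantumFieldTheory.Balaban1983to89.B13GreenStationLocated
import Literature.MathematicalPhysics.QuantumFieldTheory.Balaban1983to89.B13GreenSymLettersOfReg335

/-!
# `Balaban1983to89.B13CoerciveAlongPencilAtOne` — T. Bałaban, *Propagators for lattice gauge theories in a background field*, Commun. Math. Phys. **99** (1985) 389–434
# [Balaban1985BackgroundPropagators], (3.26)–(3.27) p. 395 («Δ_a = Δ + DRD* + Q*aQ»), (3.34)–(3.35) p. 396, Thm 3.4 p. 400 («small perturbations of the operators depending on U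
# only»), Thm 3.10 (3.107)–(3.108) p. 416, Thm 3.11 p. 416 («the operators Δ′_a, G′, (Q′G′²Q′*)⁻¹, Δ_a, G are positive definite»); *Propagators … II*, CMP **96** (1984)
# [Balaban1984PropagatorsII] (2.19) and p. 226 (the flat case); *Renormalization group approach … II*, CMP **116** (1988) [Balaban1988RG2Cluster] (2.5)–(2.7) pp. 12–13, p. 15:
# ★★★ ROW 17's CLAUSE `PosDefTr 1 (Δ_a(e^{iηA′}·1))` ON AN OPEN CHART BALL AROUND THE PURE-GAUGE ORBIT — NO DISPLAYED HYPOTHESIS.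

statement-level composition of cited tree theorems; kernel-checked; THEOREMS ONLY; nothing of NODE 00's ∕ N06's ∕ the lane's files is modified; nothing here is a claim
about the Yang–Mills mass gap; no node is discharged; count-neutral.

WHY THIS FILE (cell `pub-ymgap`, HUMAN RULING D-0062 ∕ D-0149, Track A node N10 = [B13]; width seat `pub-ymgap-dag-n10-w2` g4, CLAIM-12; the `…_one` located edition of the
lane owner dag-n10-c g16's module 83 `B13CoerciveAlongPencil`, offered to the width seats INBOX l.≈37000).  Module 83 proves Theorem 3.11's clause for NODE 00's `Δ_a`
on a located chart ball around ANY background at which `Δ_a` is coercive, from Δ_a's pencil letters (`posDefTr_deltaAY_prodCfg_of_coer_centre`,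
`…_gaugeY_prodCfg_of_coer_centre`).  At the unit background every input is a TREE theorem: the coercivity of def-Y's v4 `Δ_a(1)` is n06-j's
`posDefTr_deltaAY_parSymY_one` read by `exists_pos_coer_of_posDefTr` (`B13GreenCentreDecayOfCoercive.exists_coercive_deltaAY_parSymY_one`, ∃γ per member); Δ_a's pencil
letters at `1` follow BY NAME from the located stations of the v4 inverse road on (3.35) (`1 ∈ (3.35)` by `reg335_one`): R with NO X⁻¹ letter (this seat's
`B13OpsYPencilRProjSymLocated` §2, over dag-n10-w5's located X⁻¹ knit and dag-n10-w6's located G′), the local part `Δ(U) + Q*aQ(U)` (dag-n10-w4's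
`B13DeltaAPencilLettersLocated` §4), the `D R D*` assembly (this lineage's `B13OpsYPencilGreen` §3 with dag-n10-w4's `D ∕ D*` numerals and readings), the X⁻¹ rate window chosen
inside by `NodeOLettersSqrtExpDecay.exists_uniform_rate` (as in `B13GreenSymLettersOfReg335` §2).  Hence row 17's clause holds, with NO displayed analytic or dictionary
hypothesis, on an explicit OPEN neighbourhood (in pv27's chart) of the unit background — and, by (3.34), of the whole pure-gauge orbit: an open, gauge-invariant inhabitant class
of the N06 certificate's row-17 clause (the tree's inhabitants so far: the orbit itself, `A′ = 0`).
* §1 ★★ `exists_rawEntryLetters_toMatrix_deltaAY_recordV4_prodCfg_one_located` — for every `η` and `G ≤ U(N)`: `∃ R₁ > 0, ∃ ρ > 0, ∃ B, RawEntryLetters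
  (A′ ↦ toMatrix B′ B′ (Δ_a(e^{iηA′}·1))) (bondReadingY i i.hN ∘ fst) R₁ ρ B` at the v4 letters of record — Δ_a's pencil letters at the unit background, NO hypothesis.
* §2 ★★★ `exists_ball_posDefTr_deltaAY_parSymY_prodCfg_one` — `∃ R′ > 0, ∀ ‖A′‖ < R′, PosDefTr 1 (deltaAY i (parSymY i) (parBY i) (GpY i (parSymY i)) (prodCfg 1 η A′))`;
  ★★★ `exists_ball_posDefTr_deltaAY_parSymY_gaugeY_prodCfg_one` — the same on the gauge orbit of that ball (unitary-valued gauge transformations).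
HONEST FRAMING: a composition BY NAME; the radius `R′` is EXISTENTIAL (the flat centre's coercivity constant `γ` is n06-j's ∃, per member — not located) and lives in pv27's
CHART around `U₀ = 1` (globally small `A′`), NOT in print's class (3.35); the chart-to-(3.35) passage is print's (3.105)–(3.108) gluing (N06's), untouched; finite-lattice
constants; nothing of Bałaban's asserted beyond the cited theorems; N06 ∕ N10 NOT discharged; K1⁹ NOT claimed; counts unmoved (typed 28∕28 · discharged 5∕27); 0 `def`,
0 `sorry`, standard axioms; one finite 𝕋⁴ programme at fixed ε — R4 closes the conditional finite-𝕋⁴ rung `BalabanLadder.UV` only; the YM mass gap (Clay) is NOT proved by any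
of this; nothing continuum ∕ ℝ⁴ ∕ OS.

References: T. Bałaban, CMP 99 (1985) 389–434 [Balaban1985BackgroundPropagators] (3.26)–(3.27) p.395, (3.34)–(3.35) p.396, Thm 3.1 (3.42) p.397, Thm 3.2 (3.48) p.398, Thm 3.4
p.400, (3.60)–(3.65) p.402, (3.66)–(3.68) p.403, (3.69)–(3.70) p.404, (3.71)–(3.72) p.405, Thm 3.10 (3.107)–(3.108) p.416, Thm 3.11 p.416; CMP 96 (1984) 223–250
[Balaban1984PropagatorsII] (2.19) and p.226, Lemma 2.1 (2.61) p.234; CMP 116 (1988) 1–22 [Balaban1988RG2Cluster] (2.5)–(2.7) pp.12–13, p.15, (2.16) p.16.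
-/

noncomputable section

namespace Literature.MathematicalPhysics.QuantumFieldTheory.Balaban1983to89.B13CoerciveAlongPencilAtOne

open Metric Set Finset Module
open scoped Matrix Matrix.Norms.L2Operator
open Literature.MathematicalPhysics.QuantumFieldTheory.Balaban1983to89
open Literature.MathematicalPhysics.QuantumFieldTheory.Balaban1983to89.B9Thm37GlueTorus (tdist1)
open Literature.MathematicalPhysics.QuantumFieldTheory.Balaban1983to89.B5TorusCover (UT)
open Literature.MathematicalPhysics.QuantumFieldTheory.Balaban1983to89.B9Thm311ReadingCoords (trIP PosDefTr)
open Literature.MathematicalPhysics.QuantumFieldTheory.Balaban1983to89.B13EntrywiseWalks (RawEntryLetters)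
open Literature.MathematicalPhysics.QuantumFieldTheory.Balaban1983to89.B9Eq39Adjoint (prodCfg)
open Literature.MathematicalPhysics.QuantumFieldTheory.Balaban1983to89.B6GlobalChartV1 (PV boxEquiv)
open Literature.MathematicalPhysics.QuantumFieldTheory.Balaban1983to89.B6KLevelCensusIndexV1 (KIdx kGeo)
open Literature.MathematicalPhysics.QuantumFieldTheory.Balaban1983to89.B9BackgroundsKLevelV1 (bg9K reg335_one eta_pos_L_one_le_M_pos)
open Literature.MathematicalPhysics.QuantumFieldTheory.Balaban1983to89.Node00
  (SiteY FBondY BlkY CfgY GaugeY gaugeY toKT parSymY parBY GpY deltaAY RY)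
open Literature.MathematicalPhysics.QuantumFieldTheory.Balaban1983to89.B13MatrixUnitBasisNumerals (norm_stdBasis_repr_le norm_stdBasis_le_one)
open Literature.MathematicalPhysics.QuantumFieldTheory.Balaban1983to89.B13GreenPrimeSymLettersOfReg335 (norm_unit_le_one_of_mem)
open Literature.MathematicalPhysics.QuantumFieldTheory.Balaban1983to89.B13OpsYPencilGreen (rawEntryLetters_toMatrix_deltaAY_prodCfg)
open Literature.MathematicalPhysics.QuantumFieldTheory.Balaban1983to89.B13OpsYPencilRProjSymLocated
  (rawEntryLetters_toMatrix_RY_parSymY_prodCfg_of_reg335_located_of_xinvLocated)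
open Literature.MathematicalPhysics.QuantumFieldTheory.Balaban1983to89.B13SiteReadingNumerals (fineReadingY)
open Literature.MathematicalPhysics.QuantumFieldTheory.Balaban1983to89.B13BlockBondReadingNumerals
  (bondReadingY hℓG_bondReadingY hℓD_bondReadingY card_fibre_bondReadingY_matrixUnits)
open Literature.MathematicalPhysics.QuantumFieldTheory.Balaban1983to89.B13DeltaAPencilLettersLocated (rawEntryLetters_toMatrix_localDeltaA_prodCfg_located)
open Literature.MathematicalPhysics.QuantumFieldTheory.Balaban1983to89.B13GreenStationLocated (sum_abs_gradK_le sum_abs_divK_le)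
open Literature.MathematicalPhysics.QuantumFieldTheory.Balaban1983to89.B13GreenCentreDecayOfCoercive (exists_coercive_deltaAY_parSymY_one)
open Literature.MathematicalPhysics.QuantumFieldTheory.Balaban1983to89.B13CoerciveAlongPencil
  (posDefTr_deltaAY_prodCfg_of_coer_centre posDefTr_deltaAY_parSymY_gaugeY_prodCfg_of_coer_centre)
open Literature.MathematicalPhysics.QuantumFieldTheory.Balaban1983to89.NodeOLettersSqrtExpDecay (exists_uniform_rate)
open Literature.MathematicalPhysics.QuantumFieldTheory.Balaban1983to89.B6RandomWalk (c0_nonneg)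

variable {d ℓ : ℕ} {hd : 1 ≤ d + 1} {hL : Odd (ℓ + 1) ∧ 1 < ℓ + 1} {b₀ b₁ : ℝ}
variable (i : KIdx d ℓ hd hL b₀ b₁) {N : ℕ} [NeZero N] {G : Subgroup (Matrix (Fin N) (Fin N) ℂ)ˣ}

/-! ## §1. ★★ Δ_a's pencil letters at the unit background — every input a tree theorem -/

section Letters

/-- ★★ **`Δ_a(e^{iηA′}·1)` IN N10 COORDINATES, NO HYPOTHESIS.**  For every pencil scale `η` and every `G ≤ U(N)`, at def-Y's v4 letters of record (`parSymY`, `parBY`,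
`G′ = GpY i (parSymY i)`), matrix-unit coordinates, bonds read by `bondReadingY i i.hN`: `∃ R₁ > 0, ∃ ρ > 0, ∃ B, RawEntryLetters (A′ ↦ toMatrix B′ B′ (Δ_a(e^{iηA′}·1)))
(bondReadingY ∘ fst) R₁ ρ B` — the R-station on (3.35) with NO X⁻¹ letter at `U₀ = 1` (`reg335_one` with `c = 1`, `α₀ = 1∕(16(M(d+1)+1))`; the X⁻¹ rate window by
`exists_uniform_rate`), the located local part, the `D R D*` assembly, BY NAME.
[cite: Balaban1985BackgroundPropagators, (3.26)–(3.27) p.395, (3.35) p.396, Thm 3.1 (3.42) p.397, Thm 3.2 (3.48) p.398, Thm 3.4 p.400, (3.60)–(3.65) p.402, (3.66)–(3.68) p.403,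
Thm 3.10 (3.107)–(3.108) p.416; Balaban1988RG2Cluster, (2.5)–(2.7) pp.12–13, p.15; Balaban1984PropagatorsII, Lemma 2.1 (2.61) p.234] -/
theorem exists_rawEntryLetters_toMatrix_deltaAY_recordV4_prodCfg_one_located
    (hG : G ≤ B7Prop2Explicit.unitaryUnits (Matrix (Fin N) (Fin N) ℂ)) (η : ℝ) :
    ∃ R₁ : ℝ, 0 < R₁ ∧ ∃ ρ : ℝ, 0 < ρ ∧ ∃ B : ℝ,
      RawEntryLetters (fun a : Fin (d + 1) → Site (PV d ℓ i.m i.K hd hL) 0 → Matrix (Fin N) (Fin N) ℂ =>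
          LinearMap.toMatrix
            ((Pi.basis fun _ : FBondY i => Matrix.stdBasis ℂ (Fin N) (Fin N)).reindex (Equiv.sigmaEquivProd (FBondY i) (Fin N × Fin N)))
            ((Pi.basis fun _ : FBondY i => Matrix.stdBasis ℂ (Fin N) (Fin N)).reindex (Equiv.sigmaEquivProd (FBondY i) (Fin N × Fin N)))
            (deltaAY i (parSymY i) (parBY i) (GpY i (parSymY i))
              (prodCfg ((bg9K (Matrix (Fin N) (Fin N) ℂ) G i).one) η a)))
        (fun p : FBondY i × (Fin N × Fin N) => bondReadingY i i.hN p.1) R₁ ρ B := by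
  -- (3.35) at the unit background: `c = 1`, `α₀ = 1∕(16(M(d+1)+1))`
  obtain ⟨-, -, hM⟩ := eta_pos_L_one_le_M_pos i
  have hden : 0 < 16 * ((kGeo i).M * ((d : ℝ) + 1) + 1) := by positivity
  have hα : 0 < (16 * ((kGeo i).M * ((d : ℝ) + 1) + 1))⁻¹ := inv_pos.2 hden
  have hC0 : 0 ≤ 1 * (kGeo i).M * (16 * ((kGeo i).M * ((d : ℝ) + 1) + 1))⁻¹ := by positivity
  have hC1 : 1 * (kGeo i).M * (16 * ((kGeo i).M * ((d : ℝ) + 1) + 1))⁻¹ * ((d : ℝ) + 1) ≤ 1 / 16 := by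
    have hx : 0 ≤ (kGeo i).M * ((d : ℝ) + 1) := by positivity
    rw [show 1 * (kGeo i).M * (16 * ((kGeo i).M * ((d : ℝ) + 1) + 1))⁻¹ * ((d : ℝ) + 1) =
      ((kGeo i).M * ((d : ℝ) + 1)) / (16 * ((kGeo i).M * ((d : ℝ) + 1) + 1)) by field_simp,
      div_le_div_iff₀ hden (by norm_num : (0 : ℝ) < 16)]
    nlinarith
  have hreg := reg335_one (𝔸 := Matrix (Fin N) (Fin N) ℂ) (G := G) i one_pos hα
  obtain ⟨hU, hUi⟩ := norm_unit_le_one_of_mem i hG hreg.1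
  -- the rate chain: fine-reading rate numeral, target rate `ρ′`, X⁻¹ loss `μ_X`, X⁻¹ rate `κ_X` by `exists_uniform_rate`
  set κf : ℝ := (((d : ℝ) + 1) * ((((ℓ + 1) ^ i.k : ℕ) : ℝ)))⁻¹ with hκf
  have hκf0 : 0 < κf := by positivity
  have hδ : 0 < (1 / (4 * ((d : ℝ) + 2))) * κf := by positivity
  set ρ' : ℝ := (1 / (4 * ((d : ℝ) + 2))) * κf / 2 with hρ'def
  have hρ'0 : 0 < ρ' := by positivity
  have hρ' : ρ' < (1 / (4 * ((d : ℝ) + 2))) * ((((d : ℝ) + 1) * ((((ℓ + 1) ^ i.k : ℕ) : ℝ)))⁻¹) := by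
    show (1 / (4 * ((d : ℝ) + 2))) * κf / 2 < (1 / (4 * ((d : ℝ) + 2))) * κf; linarith
  have hμX : 0 < ρ' / 2 := half_pos hρ'0
  have hμρ : ρ' / 2 < ρ' := half_lt_self hρ'0
  have hκ₀ : 0 < ρ' - ρ' / 2 := by linarith
  have hm0 : (0 : ℝ) < ((4 * ((d : ℝ) + 1) + 1) ^ 2)⁻¹ := by positivity
  have ha0 : 0 ≤ Real.sqrt ((((ℓ : ℝ) + 1) ^ i.k) ^ (d + 1)) *
        (1 * (Fintype.card (Fin N × Fin N) : ℝ) *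
            (1 * ((1 * Real.exp (|η| * 1)) ^ ((d + 1) * ((ℓ + 1) ^ i.k - 1)) * 1 * (1 * Real.exp (|η| * 1)) ^ ((d + 1) * ((ℓ + 1) ^ i.k - 1)))) *
          ((((ℓ : ℝ) + 1) ^ i.k) ^ (d + 1) * (Fintype.card (Fin N × Fin N) : ℝ) *
            (1 * ((1 * Real.exp (|η| * 1)) ^ ((d + 1) * ((ℓ + 1) ^ i.k - 1)) * 1 * (1 * Real.exp (|η| * 1)) ^ ((d + 1) * ((ℓ + 1) ^ i.k - 1))))) *
          ((2 * (1 * 1 * (16 * ((((ℓ + 1) ^ i.k : ℕ) : ℝ)) ^ 2 * Real.sqrt N))) * (2 * (1 * 1 * (16 * ((((ℓ + 1) ^ i.k : ℕ) : ℝ)) ^ 2 * Real.sqrt N))) *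
            (((N * N : ℕ) : ℝ) * B6.c0 1 (ρ' / 2) ^ (d + 1))) *
          Real.exp (2 * (ρ' - ρ' / 2) * (((d : ℝ) + 1) * (((((ℓ + 1) ^ i.k : ℕ) : ℝ)) - 1)))) := by
    have hc0 : 0 ≤ B6.c0 1 (ρ' / 2) := c0_nonneg _ _
    positivity
  have hV0 : 0 ≤ ((N * N : ℕ) : ℝ) * B6.c0 1 ((ρ' - ρ' / 2) / 2) ^ (d + 1) := mul_nonneg (Nat.cast_nonneg _) (pow_nonneg (c0_nonneg _ _) _)
  obtain ⟨κX, hκX0, hκX4, hκXm⟩ := exists_uniform_rate (m := ((4 * ((d : ℝ) + 1) + 1) ^ 2)⁻¹) (κ₀ := ρ' - ρ' / 2) hm0 hκ₀ ha0 hV0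
  -- R along the pencil on (3.35) at `U₀ = 1`, NO X⁻¹ letter (this seat's located R-station §2), at rate `κ_X∕2 − 2·(κ_X∕8) = κ_X∕4`
  have hρ''0 : 0 ≤ κX / 2 := by positivity
  have hρ'' : κX / 2 < κX := half_lt_self hκX0
  have hμ : 0 < κX / 8 := by positivity
  have h2μ : 2 * (κX / 8) ≤ κX / 2 := by linarith
  obtain ⟨R₁, hR₁, -, hR⟩ := rawEntryLetters_toMatrix_RY_parSymY_prodCfg_of_reg335_located_of_xinvLocated i hG hC0 hC1 hreg η one_pos hρ'0.le hρ'
    hμX hμρ hκX0.le hκX4 hκXm hρ''0 hρ'' hμ h2μ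
  have hρR : 0 < κX / 2 - 2 * (κX / 8) := by linarith
  -- the local part along the pencil, located (dag-n10-w4's 76 §4), at the same radius and rate
  have hLoc := rawEntryLetters_toMatrix_localDeltaA_prodCfg_located i hG hreg.1 i.hN η hR₁.le hρR.le
  -- Δ_a along the pencil: `D R D*` from R (this lineage's G-station §3) + the local part
  have hCg : (0 : ℝ) ≤ 2 * |i.cf| := by positivity
  have hA := rawEntryLetters_toMatrix_deltaAY_prodCfg i (Matrix.stdBasis ℂ (Fin N) (Fin N)) ((bg9K (Matrix (Fin N) (Fin N) ℂ) G i).one) η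
    (parSymY i) (parBY i) (GpY i (parSymY i)) hU hUi le_rfl hR₁.le hCg (sum_abs_gradK_le i) hCg (sum_abs_divK_le i) norm_stdBasis_repr_le zero_le_one
    norm_stdBasis_le_one zero_le_one (fineReadingY i i.hN) (bondReadingY i i.hN) (hℓG_bondReadingY i i.hN) (hℓD_bondReadingY i i.hN) hρR.le hR hLoc
  exact ⟨R₁, hR₁, κX / 2 - 2 * (κX / 8), hρR, _, hA⟩

end Letters

/-! ## §2. ★★★ Row 17's clause on an open chart ball around the pure-gauge orbit — no displayed hypothesis -/

section Ball

/-- ★★★ **ROW 17's CLAUSE ON AN OPEN CHART BALL AROUND THE UNIT BACKGROUND.**  For every pencil scale `η` and every `G ≤ U(N)` there is `R′ > 0` such that for every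
`A′` with `‖A′‖ < R′`: `PosDefTr 1 (deltaAY i (parSymY i) (parBY i) (GpY i (parSymY i)) (prodCfg 1 η A′))` — Theorem 3.11's clause for def-Y's GENUINE v4 `Δ_a` at the
background `e^{iηA′}·1`, with NO displayed analytic or dictionary hypothesis: module 83's `posDefTr_deltaAY_prodCfg_of_coer_centre` at the centre `1` (coercive by n06-j's
`posDefTr_deltaAY_parSymY_one` read by `exists_pos_coer_of_posDefTr`) with §1's letters and the located fibre bound `m_F = (d+1)N²`; `R′ := γ·R₁∕(2·B_Δ·(m_F c₀(1,ρ)^{d+1}) + γ)`.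
HONEST LABEL: `R′` is existential (the flat centre's `γ` is ∃, per member); the ball is in pv27's CHART, NOT print's class (3.35).
[cite: Balaban1985BackgroundPropagators, (3.26)–(3.27) p.395, Thm 3.4 p.400, Thm 3.10 (3.108) p.416, Thm 3.11 p.416; Balaban1984PropagatorsII, (2.19) and p.226;
Balaban1988RG2Cluster, p.15, (2.16) p.16] -/
theorem exists_ball_posDefTr_deltaAY_parSymY_prodCfg_one
    (hG : G ≤ B7Prop2Explicit.unitaryUnits (Matrix (Fin N) (Fin N) ℂ)) (η : ℝ) :
    ∃ R' : ℝ, 0 < R' ∧ ∀ a ∈ ball (0 : Fin (d + 1) → Site (PV d ℓ i.m i.K hd hL) 0 → Matrix (Fin N) (Fin N) ℂ) R',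
      PosDefTr (fun _ => (1 : ℝ))
        (deltaAY i (parSymY i) (parBY i) (GpY i (parSymY i)) (prodCfg ((bg9K (Matrix (Fin N) (Fin N) ℂ) G i).one) η a)) := by
  -- §1's letters, with the constant named abstractly
  obtain ⟨R₁, hR₁, ρ, hρ, BΔ, hA⟩ := exists_rawEntryLetters_toMatrix_deltaAY_recordV4_prodCfg_one_located i hG η
  -- the centre's coercivity (n06-j's row-17 clause at `U = 1`, read quantitatively; `γ` existential)
  obtain ⟨m, hm, hco⟩ := exists_coercive_deltaAY_parSymY_one i (N := N)
  have hco' : ∀ Ψ : FBondY i → Matrix (Fin N) (Fin N) ℂ, m * trIP (fun _ => (1 : ℝ)) Ψ Ψ ≤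
      trIP (fun _ => (1 : ℝ)) Ψ (deltaAY i (parSymY i) (parBY i) (GpY i (parSymY i)) ((bg9K (Matrix (Fin N) (Fin N) ℂ) G i).one) Ψ) := hco
  -- the located fibre bound `m_F = (d+1)N²`
  have hfib : ∀ y, (univ.filter fun k : FBondY i × (Fin N × Fin N) => (fun p : FBondY i × (Fin N × Fin N) => bondReadingY i i.hN p.1) k = y).card ≤
      (d + 1) * (N * N) := fun y => card_fibre_bondReadingY_matrixUnits i i.hN y
  -- the radius: `K·R′ < m·R₁` with `K = 2·(B_Δ·(m_F c₀(1,ρ)^{d+1})) ≥ 0`, `R′ = m·R₁∕(K + m)`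
  set K : ℝ := 2 * (BΔ * ((((d + 1) * (N * N) : ℕ) : ℝ) * B6.c0 1 ρ ^ (d + 1))) with hK
  have hK0 : 0 ≤ K := by
    have h1 : 0 ≤ BΔ := hA.B_nonneg
    have h2 : 0 ≤ B6.c0 1 ρ := c0_nonneg _ _
    positivity
  have hKm : 0 < K + m := by linarith
  refine ⟨m * R₁ / (K + m), by positivity, ?_⟩
  have hR'R : m * R₁ / (K + m) ≤ R₁ := by
    rw [div_le_iff₀ hKm]; nlinarith
  have hsmall : K * (m * R₁ / (K + m)) < m * R₁ := by
    rw [show K * (m * R₁ / (K + m)) = (K * (m * R₁)) / (K + m) by ring, div_lt_iff₀ hKm]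
    nlinarith [mul_pos (mul_pos hm hm) hR₁]
  exact posDefTr_deltaAY_prodCfg_of_coer_centre i (parSymY i) (parBY i) (GpY i (parSymY i)) ((bg9K (Matrix (Fin N) (Fin N) ℂ) G i).one) η hA
    hρ hfib hm hco' (by positivity) hR'R hsmall

/-- ★★★ **… AND ON THE GAUGE ORBIT OF THAT BALL.**  For every unitary-valued gauge transformation `u` and every `‖A′‖ < R′` (the same `R′`, independent of `u`):
`PosDefTr 1 (Δ_a((e^{iηA′}·1)^u))` — module 83's `…_gaugeY_prodCfg_of_coer_centre` ((3.34) via n06-j's `posDefTr_deltaAY_parSymY_gaugeY_iff`): row 17's clause holds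
on an OPEN, GAUGE-INVARIANT neighbourhood of the pure-gauge orbit (the tree's inhabitants so far being the orbit itself, `A′ = 0`), with NO displayed hypothesis.
[cite: Balaban1985BackgroundPropagators, (3.34)–(3.35) p.396, Thm 3.4 p.400, Thm 3.11 p.416; Balaban1984PropagatorsII, p.226; Balaban1988RG2Cluster, p.15] -/
theorem exists_ball_posDefTr_deltaAY_parSymY_gaugeY_prodCfg_one
    (hG : G ≤ B7Prop2Explicit.unitaryUnits (Matrix (Fin N) (Fin N) ℂ)) (η : ℝ) :
    ∃ R' : ℝ, 0 < R' ∧ ∀ {u : GaugeY (Matrix (Fin N) (Fin N) ℂ) i},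
      (∀ x, ((u x : (Matrix (Fin N) (Fin N) ℂ)ˣ) : Matrix (Fin N) (Fin N) ℂ) ∈ unitary _) →
      ∀ a ∈ ball (0 : Fin (d + 1) → Site (PV d ℓ i.m i.K hd hL) 0 → Matrix (Fin N) (Fin N) ℂ) R',
        PosDefTr (fun _ => (1 : ℝ))
          (deltaAY i (parSymY i) (parBY i) (GpY i (parSymY i)) (gaugeY i u (prodCfg ((bg9K (Matrix (Fin N) (Fin N) ℂ) G i).one) η a))) := by
  obtain ⟨R₁, hR₁, ρ, hρ, BΔ, hA⟩ := exists_rawEntryLetters_toMatrix_deltaAY_recordV4_prodCfg_one_located i hG η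
  obtain ⟨m, hm, hco⟩ := exists_coercive_deltaAY_parSymY_one i (N := N)
  have hco' : ∀ Ψ : FBondY i → Matrix (Fin N) (Fin N) ℂ, m * trIP (fun _ => (1 : ℝ)) Ψ Ψ ≤
      trIP (fun _ => (1 : ℝ)) Ψ (deltaAY i (parSymY i) (parBY i) (GpY i (parSymY i)) ((bg9K (Matrix (Fin N) (Fin N) ℂ) G i).one) Ψ) := hco
  have hfib : ∀ y, (univ.filter fun k : FBondY i × (Fin N × Fin N) => (fun p : FBondY i × (Fin N × Fin N) => bondReadingY i i.hN p.1) k = y).card ≤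
      (d + 1) * (N * N) := fun y => card_fibre_bondReadingY_matrixUnits i i.hN y
  set K : ℝ := 2 * (BΔ * ((((d + 1) * (N * N) : ℕ) : ℝ) * B6.c0 1 ρ ^ (d + 1))) with hK
  have hK0 : 0 ≤ K := by
    have h1 : 0 ≤ BΔ := hA.B_nonneg
    have h2 : 0 ≤ B6.c0 1 ρ := c0_nonneg _ _
    positivity
  have hKm : 0 < K + m := by linarith
  refine ⟨m * R₁ / (K + m), by positivity, fun hu => ?_⟩
  have hR'R : m * R₁ / (K + m) ≤ R₁ := by
    rw [div_le_iff₀ hKm]; nlinarith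
  have hsmall : K * (m * R₁ / (K + m)) < m * R₁ := by
    rw [show K * (m * R₁ / (K + m)) = (K * (m * R₁)) / (K + m) by ring, div_lt_iff₀ hKm]
    nlinarith [mul_pos (mul_pos hm hm) hR₁]
  exact posDefTr_deltaAY_parSymY_gaugeY_prodCfg_of_coer_centre i ((bg9K (Matrix (Fin N) (Fin N) ℂ) G i).one) η hA hρ hfib hm hco'
    (by positivity) hR'R hsmall hu

end Ball

end Literature.MathematicalPhysics.QuantumFieldTheory.Balaban1983to89.B13CoerciveAlongPencilAtOne

end
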